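import Summits.KontsevichZagierPeriods.KontsevichZagierPeriods.Theorems.LinRedNormalFormArrangementNormalFormStubRebaseSimplePosOneFibreParUnfold
import Summits.KontsevichZagierPeriods.KontsevichZagierPeriods.Theorems.LinRedNormalFormArrangementNormalFormStubRebaseSimplePosOneFibreParCoords

/-!
# Stub `stub_rebaseSimplePosOne`, residual hypothesis `Hpar` (crux `ArrangementNormalForm`,
line `janus-bands`, v6.2) — sub-part `ParExchange`

Step UNFOLD + CYCLE of the UNFOLD–EXCHANGE treatment of a THIN parallel band (one lettered fibre,
bounds parallel in `y`, base pole `1/(y − ℓ₂(x'))`), uniformly in the silent coordinates `x'`.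
INPUT (sub-part `ParThin` produces it by the shear `t' = t − u(x', y)` and cuts): a
representation `s₂` on `{(x', y, t') | rows M₃(x', t') > 0, ylo(x') < y < yhi(x')}` with the
literal integrand `R(x')/(y − ℓ₂(x')) · 1/(t' + u(x', y))`, `u = s y + u₀(x')`, `s ≠ 0`, i.e.
`(R/s)/((y − ℓ₂)(y − τ))` with `τ = −(t' + u₀)/s`; two forms `A < Bf` on the output base
`(x', t')` with `{A, Bf} = {τ, ℓ₂}` (`hABset`), and `y` NEVER BETWEEN them on the domain
(`hlegO`: `Bf ≤ ylo` or `yhi ≤ A` over the output rows). Then (`RebasePos.unfold_cycle`)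
`1/((y − A)(y − Bf)) = (1/(Bf − A)) ∫_A^{Bf} dσ/(y − σ)²` is a legal UNFOLDING
(`RebasePos.unfold_pack`; the unfolded band converges absolutely by Tonelli, its `σ`-fibre
integrals of `|f|` being `|s₂.integrand|`), and after the 3-cycle of the last three coordinates
(`RebasePos.comp_cycle3`) the unfolded representation `U'` lives on
`{(x', t', σ, y) | (x', t', σ) ∈ gDom M₃ (A, Bf), ylo(x') < y < yhi(x')}` with integrand
`(R(x')/s)/(Bf − A)(x', t') · (y − σ)^{-2}` and `[s₂] − [U'] ∈ KZ.relations`: the variable `y`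
now sits LAST, in a pole of order two, over a literal base — ready to be integrated out
(sub-part `ParSplit`). Registered as `rebaseSimplePos_unfoldCycle`.

References: M. Kontsevich, D. Zagier, *Periods* (2001), §1.2, rules (2), (3).
-/

noncomputable section

open Set MeasureTheory MvPolynomial
open Literature.NumberTheory.Transcendental Literature.ModelTheory.ExponentialFields

namespace Summit.KontsevichZagierPeriods.ArrangementNormalForm.JanusBands

namespace RebasePos

open SeparatePos IntegrateOut

section Forms

variable {B : ℕ}

/-- A `y`-free full-base form lifted from an `x'`-form evaluates to the `x'`-form. -/
theorem affF_liftB (d : (Fin B → ℚ) × ℚ) (w : Fin (B + 1 + 1) → ℝ) :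
    affF B 1 ((Fin.snoc d.1 0 : Fin (B + 1) → ℚ), d.2) w = affB B 1 d w := by
  simp only [affF, affB, Fin.sum_univ_castSucc, Fin.snoc_castSucc, Fin.snoc_last, Rat.cast_zero,
    zero_mul, add_zero]

/-- A full-base form at the base vector of an output point. -/
theorem ev_base (c : (Fin (B + 1) → ℚ) × ℚ) (q : Fin (B + 1 + 1) → ℝ) :
    ev c (Fin.snoc (fun i : Fin B => q (Fin.castAdd 1 (Fin.castSucc i))) (q (Fin.castAdd 1 (Fin.last B))) :
      Fin (B + 1) → ℝ) = affF B 1 c q := by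
  simp only [ev, affF, Fin.sum_univ_castSucc, Fin.snoc_castSucc, Fin.snoc_last]

/-- The `τ`-form `−(t' + u₀(x'))/s` of the sheared letter, evaluated at an output point. -/
theorem affF_Tform (u : (Fin (B + 1) → ℚ) × ℚ) (w : Fin (B + 1 + 1) → ℝ) :
    affF B 1 ((Fin.snoc (fun i : Fin B => -u.1 (Fin.castSucc i) / u.1 (Fin.last B))
      (-1 / u.1 (Fin.last B)) : Fin (B + 1) → ℚ), -u.2 / u.1 (Fin.last B)) w =
      -(w (Fin.castAdd 1 (Fin.last B)) + affB B 1 (restr B u) w) / (u.1 (Fin.last B) : ℝ) := by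
  simp only [affF, affB, restr, Fin.sum_univ_castSucc, Fin.snoc_castSucc, Fin.snoc_last]
  push_cast
  simp only [neg_div, neg_mul, Finset.sum_neg_distrib, div_mul_eq_mul_div, ← Finset.sum_div]
  ring

/-- The semialgebraicity of the `x'`-rational factor `R(x') = p(x')/∏ Lⱼ(x')^{eⱼ}` (read at the
`x'`-slots of a point of `ℝ^{B+2}`) on any semialgebraic set. -/
theorem isSemialgebraicFunOn_ratX {m : ℕ} (L : Fin m → (Fin B → ℚ) × ℚ) (e : Fin m → ℕ)
    (p : MvPolynomial (Fin B) ℚ) {S : Set (Fin (B + 1 + 1) → ℝ)} (hS : IsSemialgebraic ℚ S) :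
    IsSemialgebraicFunOn ℚ S (fun q => MvPolynomial.aeval (fun i => q (Fin.castAdd 1 (Fin.castSucc i))) p /
      ∏ j, (affB B 1 (L j) q) ^ e j) := by
  refine (isSemialgebraicFunOn_div (isSemialgebraicFunOn_aeval hS
    (rename (fun i : Fin B => Fin.castAdd 1 (Fin.castSucc i)) p))
    (isSemialgebraicFunOn_aeval hS (∏ j, SeparatePos.affPoly B 1 (L j) ^ e j))).congr fun q _ => ?_
  simp only [aeval_rename, Function.comp_def, map_prod, map_pow, SeparatePos.aeval_affPoly]

/-- The semialgebraicity of a full-base form (output coordinates) on any semialgebraic set. -/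
theorem isSemialgebraicFunOn_affF' (c : (Fin (B + 1) → ℚ) × ℚ) {S : Set (Fin (B + 1 + 1) → ℝ)}
    (hS : IsSemialgebraic ℚ S) : IsSemialgebraicFunOn ℚ S (affF B 1 c) :=
  (isSemialgebraicFunOn_aeval hS (affFPoly (K := 1) c)).congr fun q _ => aeval_affFPoly c q

/-- The semialgebraicity of an `x'`-form on any semialgebraic set. -/
theorem isSemialgebraicFunOn_affB' (d : (Fin B → ℚ) × ℚ) {S : Set (Fin (B + 1 + 1) → ℝ)}
    (hS : IsSemialgebraic ℚ S) : IsSemialgebraicFunOn ℚ S (affB B 1 d) :=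
  (isSemialgebraicFunOn_aeval hS (SeparatePos.affPoly B 1 d)).congr fun q _ => SeparatePos.aeval_affPoly d q

/-- The semialgebraicity of a full-base form read at the output base vector `(x', t')` of an
input point. -/
theorem isSemialgebraicFunOn_evOut (c : (Fin (B + 1) → ℚ) × ℚ) {S : Set (Fin (B + 1 + 1) → ℝ)}
    (hS : IsSemialgebraic ℚ S) : IsSemialgebraicFunOn ℚ S (fun z =>
      ev c (Fin.snoc (fun i : Fin B => z (Fin.castAdd 1 (Fin.castSucc i))) (z (Fin.natAdd (B + 1) 0)) :
        Fin (B + 1) → ℝ)) := by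
  refine (isSemialgebraicFunOn_aeval hS (SeparatePos.affPoly B 1 (restr B c) +
    MvPolynomial.C (c.1 (Fin.last B)) * X (Fin.natAdd (B + 1) 0))).congr fun z _ => ?_
  simp only [map_add, map_mul, SeparatePos.aeval_affPoly, MvPolynomial.aeval_C, aeval_X, ev_outBase,
    eq_ratCast]

end Forms

section UnfoldCycle

variable {B m m₃ : ℕ} (L : Fin m → (Fin B → ℚ) × ℚ) (e : Fin m → ℕ) (p₃ : MvPolynomial (Fin B) ℚ)
  (ℓ₁ ℓ₂ : (Fin B → ℚ) × ℚ) (u : (Fin (B + 1) → ℚ) × ℚ) (M₃ : Fin m₃ → (Fin (B + 1) → ℚ) × ℚ)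
  (A Bf : (Fin (B + 1) → ℚ) × ℚ) (ylo yhi : (Fin B → ℚ) × ℚ)

/-- **UNFOLD + CYCLE.** See the module docstring. -/
theorem unfold_cycle (s₂ : KZ.IntegralRep (B + 1 + 1))
    (hd₂ : ∀ z, z ∈ s₂.domain ↔ (∀ j, 0 < ev (M₃ j) (Fin.snoc (fun i : Fin B => z (Fin.castAdd 1 (Fin.castSucc i)))
      (z (Fin.natAdd (B + 1) 0)) : Fin (B + 1) → ℝ)) ∧ affB B 1 ylo z < z (Fin.castAdd 1 (Fin.last B)) ∧
      z (Fin.castAdd 1 (Fin.last B)) < affB B 1 yhi z)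
    (hi₂ : EqOn s₂.integrand (glit B 1 p₃ L e ℓ₁ ℓ₂ 0 1 (fun _ => some (-u))) s₂.domain)
    (hs : u.1 (Fin.last B) ≠ 0)
    (hABset : (A = ((Fin.snoc (fun i : Fin B => -u.1 (Fin.castSucc i) / u.1 (Fin.last B))
        (-1 / u.1 (Fin.last B)) : Fin (B + 1) → ℚ), -u.2 / u.1 (Fin.last B)) ∧
        Bf = ((Fin.snoc ℓ₂.1 0 : Fin (B + 1) → ℚ), ℓ₂.2)) ∨
      (A = ((Fin.snoc ℓ₂.1 0 : Fin (B + 1) → ℚ), ℓ₂.2) ∧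
        Bf = ((Fin.snoc (fun i : Fin B => -u.1 (Fin.castSucc i) / u.1 (Fin.last B))
        (-1 / u.1 (Fin.last B)) : Fin (B + 1) → ℚ), -u.2 / u.1 (Fin.last B))))
    (hABo : ∀ w : Fin (B + 1 + 1) → ℝ, (∀ j, 0 < affF B 1 (M₃ j) w) → affF B 1 A w < affF B 1 Bf w)
    (hlegO : (∀ w : Fin (B + 1 + 1) → ℝ, (∀ j, 0 < affF B 1 (M₃ j) w) → affF B 1 Bf w ≤ affB B 1 ylo w) ∨
      (∀ w : Fin (B + 1 + 1) → ℝ, (∀ j, 0 < affF B 1 (M₃ j) w) → affB B 1 yhi w ≤ affF B 1 A w)) :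
    ∃ U' : KZ.IntegralRep (B + 1 + 1 + 1),
      U'.domain = {w | (Fin.init w : Fin (B + 1 + 1) → ℝ) ∈ gDom B 1 m₃ M₃ (fun _ => Sum.inr A) (fun _ => Sum.inr Bf) ∧
        affB B 1 ylo (Fin.init w) < w (Fin.last (B + 1 + 1)) ∧
        w (Fin.last (B + 1 + 1)) < affB B 1 yhi (Fin.init w)} ∧
      EqOn U'.integrand (fun w => MvPolynomial.aeval (fun i => Fin.init w (Fin.castAdd 1 (Fin.castSucc i))) p₃ /
        (∏ j, (affB B 1 (L j) (Fin.init w)) ^ e j) / (u.1 (Fin.last B) : ℝ) /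
        (affF B 1 Bf (Fin.init w) - affF B 1 A (Fin.init w)) /
        (w (Fin.last (B + 1 + 1)) - Fin.init w (Fin.natAdd (B + 1) (0 : Fin 1))) ^ 2) U'.domain ∧
      KZ.of s₂ - KZ.of U' ∈ KZ.relations := by
  -- local abbreviations
  set sR : ℝ := (u.1 (Fin.last B) : ℝ) with hsR
  have hs' : sR ≠ 0 := by rw [hsR]; exact_mod_cast hs
  set G : (Fin (B + 1 + 1) → ℝ) → ℝ := fun q =>
    MvPolynomial.aeval (fun i => q (Fin.castAdd 1 (Fin.castSucc i))) p₃ / ∏ j, (affB B 1 (L j) q) ^ e j with hG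
  set a : (Fin (B + 1 + 1) → ℝ) → ℝ := fun z =>
    ev A (Fin.snoc (fun i : Fin B => z (Fin.castAdd 1 (Fin.castSucc i))) (z (Fin.natAdd (B + 1) 0)) :
      Fin (B + 1) → ℝ) with ha
  set b : (Fin (B + 1 + 1) → ℝ) → ℝ := fun z =>
    ev Bf (Fin.snoc (fun i : Fin B => z (Fin.castAdd 1 (Fin.castSucc i))) (z (Fin.natAdd (B + 1) 0)) :
      Fin (B + 1) → ℝ) with hb
  set yv : (Fin (B + 1 + 1) → ℝ) → ℝ := fun z => z (Fin.castAdd 1 (Fin.last B)) with hyv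
  set fU : (Fin (B + 1 + 1 + 1) → ℝ) → ℝ := fun w =>
    G (Fin.init w) / sR / (b (Fin.init w) - a (Fin.init w)) / (yv (Fin.init w) - w (Fin.last (B + 1 + 1))) ^ 2
    with hfU
  set FU : (Fin (B + 1 + 1 + 1) → ℝ) → ℝ := fun w =>
    G (Fin.init w) / sR / (b (Fin.init w) - a (Fin.init w)) / (yv (Fin.init w) - w (Fin.last (B + 1 + 1)))
    with hFU
  set ΨU : (Fin (B + 1 + 1 + 1) → ℝ) → ℝ := fun w =>
    |G (Fin.init w) / sR| / (b (Fin.init w) - a (Fin.init w)) / (yv (Fin.init w) - w (Fin.last (B + 1 + 1)))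
    with hΨU
  -- (1) transfer of the output-side hypotheses to input points
  have htrans : ∀ z : Fin (B + 1 + 1) → ℝ, ∃ w : Fin (B + 1 + 1) → ℝ,
      (∀ j, affF B 1 (M₃ j) w = ev (M₃ j) (Fin.snoc (fun i : Fin B => z (Fin.castAdd 1 (Fin.castSucc i)))
        (z (Fin.natAdd (B + 1) 0)) : Fin (B + 1) → ℝ)) ∧
      affF B 1 A w = a z ∧ affF B 1 Bf w = b z ∧ affB B 1 ylo w = affB B 1 ylo z ∧
      affB B 1 yhi w = affB B 1 yhi z := fun z =>
    ⟨Fin.append (Fin.snoc (fun i : Fin B => z (Fin.castAdd 1 (Fin.castSucc i))) (z (Fin.natAdd (B + 1) 0)))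
      (fun _ : Fin 1 => (0 : ℝ)), fun j => affF_append _ _ _, affF_append _ _ _, affF_append _ _ _,
      affB_append_outBase _ _ _, affB_append_outBase _ _ _⟩
  have hABz : ∀ z ∈ s₂.domain, a z < b z := by
    intro z hz
    obtain ⟨w, hw, hwA, hwB, -, -⟩ := htrans z
    rw [← hwA, ← hwB]
    exact hABo w fun j => by rw [hw]; exact ((hd₂ z).1 hz).1 j
  have hlegz : (∀ z ∈ s₂.domain, b z < yv z) ∨ (∀ z ∈ s₂.domain, yv z < a z) := by
    rcases hlegO with h | h
    · refine Or.inl fun z hz => ?_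
      obtain ⟨w, hw, -, hwB, hwlo, -⟩ := htrans z
      have h1 := h w fun j => by rw [hw]; exact ((hd₂ z).1 hz).1 j
      rw [hwB, hwlo] at h1
      exact lt_of_le_of_lt h1 ((hd₂ z).1 hz).2.1
    · refine Or.inr fun z hz => ?_
      obtain ⟨w, hw, hwA, -, -, hwhi⟩ := htrans z
      have h1 := h w fun j => by rw [hw]; exact ((hd₂ z).1 hz).1 j
      rw [hwA, hwhi] at h1
      exact lt_of_lt_of_le ((hd₂ z).1 hz).2.2 h1
  have hne : ∀ z ∈ s₂.domain, ∀ t ∈ Icc (a z) (b z), yv z - t ≠ 0 := by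
    intro z hz t ht
    rcases hlegz with h | h
    · have := h z hz; intro h0; linarith [ht.2]
    · have := h z hz; intro h0; linarith [ht.1]
  have hpos : ∀ z ∈ s₂.domain, 0 < (yv z - a z) * (yv z - b z) := by
    intro z hz
    have hab := hABz z hz
    rcases hlegz with h | h
    · have := h z hz; exact mul_pos (by linarith) (by linarith)
    · have := h z hz; exact mul_pos_of_neg_of_neg (by linarith) (by linarith)
  -- (2) the input integrand in terms of `a`, `b`
  have hTin : ∀ z : Fin (B + 1 + 1) → ℝ,
      ev ((Fin.snoc (fun i : Fin B => -u.1 (Fin.castSucc i) / u.1 (Fin.last B)) (-1 / u.1 (Fin.last B)) :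
        Fin (B + 1) → ℚ), -u.2 / u.1 (Fin.last B))
        (Fin.snoc (fun i : Fin B => z (Fin.castAdd 1 (Fin.castSucc i))) (z (Fin.natAdd (B + 1) 0)) :
          Fin (B + 1) → ℝ) = -(z (Fin.natAdd (B + 1) 0) + affB B 1 (restr B u) z) / sR := by
    intro z
    rw [← affF_append _ _ (fun _ : Fin 1 => (0 : ℝ)), affF_Tform, affB_append_outBase, Fin.append_left,
      Fin.snoc_last]
  have hLin : ∀ z : Fin (B + 1 + 1) → ℝ,
      ev (((Fin.snoc ℓ₂.1 0 : Fin (B + 1) → ℚ), ℓ₂.2)) (Fin.snoc (fun i : Fin B => z (Fin.castAdd 1 (Fin.castSucc i)))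
        (z (Fin.natAdd (B + 1) 0)) : Fin (B + 1) → ℝ) = affB B 1 ℓ₂ z := by
    intro z
    rw [← affF_append _ _ (fun _ : Fin 1 => (0 : ℝ)), affF_liftB, affB_append_outBase]
  have hprod : ∀ z : Fin (B + 1 + 1) → ℝ, (yv z - a z) * (yv z - b z) =
      (yv z - affB B 1 ℓ₂ z) * (yv z + (z (Fin.natAdd (B + 1) 0) + affB B 1 (restr B u) z) / sR) := by
    intro z
    rcases hABset with ⟨hA, hB⟩ | ⟨hA, hB⟩
    · simp only [ha, hb, hA, hB, hTin, hLin]; ring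
    · simp only [ha, hb, hA, hB, hTin, hLin]; ring
  have key : ∀ z ∈ s₂.domain, s₂.integrand z = G z / sR / ((yv z - a z) * (yv z - b z)) := by
    intro z hz
    have hp := hpos z hz
    rw [hprod] at hp ⊢
    have h1 : yv z - affB B 1 ℓ₂ z ≠ 0 := fun h => by rw [h, zero_mul] at hp; exact lt_irrefl _ hp
    have h2 : yv z + (z (Fin.natAdd (B + 1) 0) + affB B 1 (restr B u) z) / sR ≠ 0 := fun h => by
      rw [h, mul_zero] at hp; exact lt_irrefl _ hp
    have h3 : z (Fin.natAdd (B + 1) 0) - affF B 1 (-u) z =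
        sR * (yv z + (z (Fin.natAdd (B + 1) 0) + affB B 1 (restr B u) z) / sR) := by
      rw [affF_neg', affF_split u z, hsR, hyv]
      field_simp
      ring
    rw [hi₂ hz, glit_one, pow_zero, pow_one, h3, hG, hyv]
    field_simp
  -- (3) semialgebraicity
  have hτ : IsSemialgebraic ℚ s₂.domain := s₂.isSemialgebraic_domain
  have haS : IsSemialgebraicFunOn ℚ s₂.domain a := isSemialgebraicFunOn_evOut A hτ
  have hbS : IsSemialgebraicFunOn ℚ s₂.domain b := isSemialgebraicFunOn_evOut Bf hτ
  have hGS : IsSemialgebraicFunOn ℚ s₂.domain G := isSemialgebraicFunOn_ratX L e p₃ hτ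
  have hyS : IsSemialgebraicFunOn ℚ s₂.domain yv := isSemialgebraicFunOn_apply hτ _
  have hBsa : IsSemialgebraic ℚ (KZlog.band s₂.domain a b) := KZlog.isSemialgebraic_band haS hbS
  have hsub : KZlog.band s₂.domain a b ⊆ {v | Fin.init v ∈ s₂.domain} := fun v hv => hv.1
  have lift : ∀ {φ : (Fin (B + 1 + 1) → ℝ) → ℝ}, IsSemialgebraicFunOn ℚ s₂.domain φ →
      IsSemialgebraicFunOn ℚ (KZlog.band s₂.domain a b) (fun v => φ (Fin.init v)) := fun h =>
    h.comp_init.mono hsub hBsa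
  have hlastS : IsSemialgebraicFunOn ℚ (KZlog.band s₂.domain a b) (fun v => v (Fin.last (B + 1 + 1))) :=
    isSemialgebraicFunOn_apply hBsa _
  have hsRS : IsSemialgebraicFunOn ℚ (KZlog.band s₂.domain a b) (fun _ => sR) :=
    isSemialgebraicFunOn_ratCast hBsa (u.1 (Fin.last B))
  have hcS : IsSemialgebraicFunOn ℚ (KZlog.band s₂.domain a b)
      (fun v => G (Fin.init v) / sR / (b (Fin.init v) - a (Fin.init v))) :=
    isSemialgebraicFunOn_div (isSemialgebraicFunOn_div (lift hGS) hsRS)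
      (IsSemialgebraicFunOn.sub_holds (lift hbS) (lift haS))
  have hlinS : IsSemialgebraicFunOn ℚ (KZlog.band s₂.domain a b)
      (fun v => yv (Fin.init v) - v (Fin.last (B + 1 + 1))) :=
    IsSemialgebraicFunOn.sub_holds (lift hyS) hlastS
  have hfS : IsSemialgebraicFunOn ℚ (KZlog.band s₂.domain a b) fU :=
    isSemialgebraicFunOn_div hcS (isSemialgebraicFunOn_pow hlinS 2)
  have hFS : IsSemialgebraicFunOn ℚ (KZlog.band s₂.domain a b) FU := isSemialgebraicFunOn_div hcS hlinS
  -- (4) fibrewise calculus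
  have hfibF : ∀ z, (fun t => FU (Fin.snoc z t)) = fun t => G z / sR / (b z - a z) / (yv z - t) := fun z => by
    funext t; simp only [hFU, Fin.init_snoc, Fin.snoc_last]
  have hfibΨ : ∀ z, (fun t => ΨU (Fin.snoc z t)) = fun t => |G z / sR| / (b z - a z) / (yv z - t) := fun z => by
    funext t; simp only [hΨU, Fin.init_snoc, Fin.snoc_last]
  have hfval : ∀ z t, fU (Fin.snoc z t) = G z / sR / (b z - a z) / (yv z - t) ^ 2 := fun z t => by
    simp only [hfU, Fin.init_snoc, Fin.snoc_last]
  have hderiv : ∀ (C y t : ℝ), y - t ≠ 0 →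
      HasDerivAt (fun s : ℝ => C / (y - s)) (C / (y - t) ^ 2) t := by
    intro C y t hyt
    have h1 : HasDerivAt (fun s : ℝ => y - s) (-1) t := (hasDerivAt_id' t).const_sub y
    have h2 : HasDerivAt (fun s : ℝ => (y - s)⁻¹) (-(-1) / (y - t) ^ 2) t := h1.inv hyt
    have h3 := h2.const_mul C
    rw [neg_neg, mul_one_div] at h3
    have hfun : (fun s : ℝ => C / (y - s)) = fun s => C * (y - s)⁻¹ := funext fun s => div_eq_mul_inv _ _
    rw [hfun]
    exact h3
  have hcontF : ∀ z ∈ s₂.domain, ContinuousOn (fun t => FU (Fin.snoc z t)) (Icc (a z) (b z)) := by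
    intro z hz
    rw [hfibF]
    exact continuousOn_const.div (continuousOn_const.sub continuousOn_id) (hne z hz)
  have hderF : ∀ z ∈ s₂.domain, ∀ t ∈ Ioo (a z) (b z),
      HasDerivAt (fun s => FU (Fin.snoc z s)) (fU (Fin.snoc z t)) t := by
    intro z hz t ht
    rw [hfibF, hfval]
    exact hderiv _ _ _ (hne z hz t (Ioo_subset_Icc_self ht))
  have hcontΨ : ∀ z ∈ s₂.domain, ContinuousOn (fun t => ΨU (Fin.snoc z t)) (Icc (a z) (b z)) := by
    intro z hz
    rw [hfibΨ]
    exact continuousOn_const.div (continuousOn_const.sub continuousOn_id) (hne z hz)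
  have hderΨ : ∀ z ∈ s₂.domain, ∀ t ∈ Ioo (a z) (b z),
      HasDerivAt (fun s => ΨU (Fin.snoc z s)) (|fU (Fin.snoc z t)|) t := by
    intro z hz t ht
    have hne' := hne z hz t (Ioo_subset_Icc_self ht)
    have habs : |fU (Fin.snoc z t)| = |G z / sR| / (b z - a z) / (yv z - t) ^ 2 := by
      rw [hfval, abs_div _ ((yv z - t) ^ 2), abs_div _ (b z - a z), abs_of_pos (sub_pos.2 (hABz z hz)),
        abs_pow, sq_abs]
    rw [hfibΨ, habs]
    exact hderiv _ _ _ hne'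
  -- (5) the increments of the primitives
  have hincr : ∀ z ∈ s₂.domain, ∀ C : ℝ, C / (b z - a z) / (yv z - b z) - C / (b z - a z) / (yv z - a z) =
      C / ((yv z - a z) * (yv z - b z)) := by
    intro z hz C
    have hab : b z - a z ≠ 0 := (sub_pos.2 (hABz z hz)).ne'
    have ha0 : yv z - a z ≠ 0 := hne z hz (a z) (left_mem_Icc.2 (hABz z hz).le)
    have hb0 : yv z - b z ≠ 0 := hne z hz (b z) (right_mem_Icc.2 (hABz z hz).le)
    field_simp
    ring
  have hr'i : EqOn s₂.integrand (fun z => FU (Fin.snoc z (b z)) - FU (Fin.snoc z (a z))) s₂.domain := by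
    intro z hz
    show s₂.integrand z = FU (Fin.snoc z (b z)) - FU (Fin.snoc z (a z))
    simp only [hFU, Fin.init_snoc, Fin.snoc_last]
    rw [key z hz, hincr z hz]
  have hΨint : IntegrableOn (fun z => ΨU (Fin.snoc z (b z)) - ΨU (Fin.snoc z (a z))) s₂.domain := by
    have hn : IntegrableOn (fun z => ‖s₂.integrand z‖) s₂.domain := s₂.integrableOn.norm
    refine hn.congr_fun (fun z hz => ?_) (KZ.IntegralRep.measurableSet_domain_holds s₂)
    show ‖s₂.integrand z‖ = ΨU (Fin.snoc z (b z)) - ΨU (Fin.snoc z (a z))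
    simp only [hΨU, Fin.init_snoc, Fin.snoc_last]
    rw [Real.norm_eq_abs, key z hz, hincr z hz, abs_div, abs_of_pos (hpos z hz)]
  -- (6) unfold, then cycle the coordinates
  obtain ⟨U, hUd, hUi, hUrel⟩ := unfold_pack hτ haS hbS hABz hfS hFS hcontF hderF hcontΨ hderΨ hΨint s₂ rfl hr'i
  set e₃ : Fin (B + 1 + 1 + 1) ≃ Fin (B + 1 + 1 + 1) :=
    (Equiv.swap (Fin.castSucc (Fin.castAdd 1 (Fin.last B)) : Fin (B + 1 + 1 + 1))
        (Fin.castSucc (Fin.natAdd (B + 1) (0 : Fin 1)))).trans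
      (Equiv.swap (Fin.castSucc (Fin.natAdd (B + 1) (0 : Fin 1))) (Fin.last (B + 1 + 1))) with he₃
  refine ⟨U.reindex e₃, ?_, ?_, ?_⟩
  · ext w
    simp only [KZ.IntegralRep.reindex_domain, mem_setOf_eq]
    rw [he₃, comp_cycle3 w, hUd, mem_setOf_eq, Fin.init_snoc, Fin.snoc_last, hd₂, mem_gDom_one]
    simp only [ha, hb, ev_inPt, affB_inPt, inPt_y]
    tauto
  · intro w _
    rw [KZ.IntegralRep.reindex_integrand]
    show U.integrand (fun i => w (e₃ i)) = _
    rw [he₃, comp_cycle3 w, hUi, hfval]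
    simp only [ha, hb, hyv, ev_inPt, inPt_y]
    simp only [hG, affB_inPt, inPt_x]
  · have h2 := IntegrateOut.of_sub_of_reindex_mem_relations U e₃
    have : KZ.of s₂ - KZ.of (U.reindex e₃) = -(KZ.of U - KZ.of s₂) + (KZ.of U - KZ.of (U.reindex e₃)) := by
      abel
    rw [this]
    exact KZ.relations.add_mem (KZ.relations.neg_mem hUrel) h2

end UnfoldCycle

end RebasePos

/-- **Registered support goal of this file: UNFOLD + CYCLE** (`RebasePos.unfold_cycle`). From the
sheared thin band `s₂` on `{rows M₃(x', t'), ylo < y < yhi}` with integrand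
`R(x')/(y − ℓ₂) · 1/(t' + u(x', y))` (`u_y ≠ 0`), forms `A < Bf` with `{A, Bf} = {τ, ℓ₂}` and
`y` never between them, the unfolded-and-cycled representation `U'` on
`{(x', t', σ, y) | (x', t', σ) ∈ gDom M₃ (A, Bf), ylo < y < yhi}` with integrand
`(R/u_y)/(Bf − A) · (y − σ)^{-2}` satisfies `[s₂] − [U'] ∈ KZ.relations`. -/
theorem rebaseSimplePos_unfoldCycle (B m m₃ : ℕ) (L : Fin m → (Fin B → ℚ) × ℚ) (e : Fin m → ℕ) (p₃ : MvPolynomial (Fin B) ℚ) (ℓ₁ ℓ₂ : (Fin B → ℚ) × ℚ) (u : (Fin (B + 1) → ℚ) × ℚ) (M₃ : Fin m₃ → (Fin (B + 1) → ℚ) × ℚ) (A Bf : (Fin (B + 1) → ℚ) × ℚ) (ylo yhi : (Fin B → ℚ) × ℚ) (s₂ : KZ.IntegralRep (B + 1 + 1)) (hd₂ : ∀ z, z ∈ s₂.domain ↔ (∀ j, 0 < IntegrateOut.ev (M₃ j) (Fin.snoc (fun i : Fin B => z (Fin.castAdd 1 (Fin.castSucc i))) (z (Fin.natAdd (B + 1)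 0)) : Fin (B + 1) → ℝ)) ∧ SeparatePos.affB B 1 ylo z < z (Fin.castAdd 1 (Fin.last B)) ∧ z (Fin.castAdd 1 (Fin.last B)) < SeparatePos.affB B 1 yhi z) (hi₂ : Set.EqOn s₂.integrand (RebasePos.glit B 1 p₃ L e ℓ₁ ℓ₂ 0 1 (fun _ => some (-u))) s₂.domain) (hs : u.1 (Fin.last B) ≠ 0) (hABset : (A = ((Fin.snoc (fun i : Fin B => -u.1 (Fin.castSucc i) / u.1 (Fin.last B)) (-1 / u.1 (Fin.last B)) : Fin (B + 1) → ℚ), -u.2 / u.1 (Fin.last B)) ∧ Bf = ((Fin.snoc ℓ₂.1 0 : Fin (B + 1) → ℚ), ℓ₂.2)) ∨ (A = ((Fin.snoc ℓ₂.1 0 : Fin (B + 1) → ℚ), ℓ₂.2) ∧ Bf = ((Fin.snoc (fun i : Fin B => -u.1 (Fin.castSucc i) / u.1 (Fin.last B)) (-1 / u.1 (Fin.last B)) : Fin (B + 1) → ℚ), -u.2 / u.1 (Fin.last B)))) (hABo : ∀ w : Fin (B + 1 + 1) → ℝ, (∀ j, 0 < SeparatePos.affF B 1 (M₃ j) w)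 → SeparatePos.affF B 1 A w < SeparatePos.affF B 1 Bf w) (hlegO : (∀ w : Fin (B + 1 + 1) → ℝ, (∀ j, 0 < SeparatePos.affF B 1 (M₃ j) w) → SeparatePos.affF B 1 Bf w ≤ SeparatePos.affB B 1 ylo w) ∨ (∀ w : Fin (B + 1 + 1) → ℝ, (∀ j, 0 < SeparatePos.affF B 1 (M₃ j) w) → SeparatePos.affB B 1 yhi w ≤ SeparatePos.affF B 1 A w)) : ∃ U' : KZ.IntegralRep (B + 1 + 1 + 1), U'.domain = {w | (Fin.init w : Fin (B + 1 + 1) → ℝ) ∈ SeparatePos.gDom B 1 m₃ M₃ (fun _ => Sum.inr A) (fun _ => Sum.inr Bf) ∧ SeparatePos.affB B 1 ylo (Fin.init w) < w (Fin.last (B + 1 + 1)) ∧ w (Fin.last (B + 1 + 1)) < SeparatePos.affB B 1 yhi (Fin.init w)} ∧ Set.EqOn U'.integrand (fun w => MvPolynomial.aeval (fun i => Fin.init w (Fin.castAdd 1 (Fin.castSucc i))) p₃ / (∏ j, (SeparatePos.affB B 1 (L j) (Fin.init w)) ^ e j) / (u.1 (Fin.last B) : ℝ) / (SeparatePos.affF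 B 1 Bf (Fin.init w) - SeparatePos.affF B 1 A (Fin.init w)) / (w (Fin.last (B + 1 + 1)) - Fin.init w (Fin.natAdd (B + 1) (0 : Fin 1))) ^ 2) U'.domain ∧ KZ.of s₂ - KZ.of U' ∈ KZ.relations :=
  RebasePos.unfold_cycle L e p₃ ℓ₁ ℓ₂ u M₃ A Bf ylo yhi s₂ hd₂ hi₂ hs hABset hABo hlegO

end Summit.KontsevichZagierPeriods.ArrangementNormalForm.JanusBands
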